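import Mathlib
import HarnessLib

/-!
# Whittaker cardinal (sinc) series and Stenger's step-size balance (Davis–Rabinowitz 1984, Sect. 3.4.6)

**Source.** P. J. Davis, P. Rabinowitz, *Methods of Numerical Integration* (2nd ed., Academic Press, 1984),
Sect. 3.4.6 "Use of Whittaker Cardinal Functions", (3.4.6.1)–(3.4.6.2), (3.4.6.9)–(3.4.6.11) (Stenger).

**Statement.** The Whittaker cardinal function of `f` with step `h` is
`C(x; f, h) = Σ_{k=−∞}^{∞} f(kh) S(x; k, h)` (3.4.6.1) with the sinc functions
`S(x; k, h) = sin[(π/h)(x − kh)] / [(π/h)(x − kh)]` (3.4.6.2); `∫ C = h Σ f(kh)` (3.4.6.3), so the rectangular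
(trapezoidal) rule on `ℝ` is the integral of the cardinal interpolant. For `f ∈ B(𝒟_d)` with
`|f(x)| ≤ A e^{−α|x|}` (3.4.6.4), the choice `h = [2πd/(αN)]^{1/2}` (3.4.6.9) gives
`|η_N(f, h)| ≤ A₁ g(α, d, N)`, `g(α, d, N) = exp[−(2πdαN)^{1/2}]` (3.4.6.10)–(3.4.6.11).

**What is typed** (all PROVED, Mathlib only):
* `sincBasis h k x = sinc((π/h)(x − kh))` (3.4.6.2) via Mathlib's `Real.sinc` (value `1` at the removable singularity):
  the CARDINAL property `S(jh; k, h) = δ_{jk}` (`sincBasis_node_self`, `sincBasis_node_of_ne`), `|S| ≤ 1`, continuity,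
  and the symmetry `S(x; k, h) = S(2kh − x; k, h)`;
* the truncated cardinal series `cardinalSum N f h x = Σ_{|k| ≤ N} f(kh) S(x; k, h)` ((3.4.6.1) truncated as in
  (3.4.6.7)): it INTERPOLATES, `C_N(jh) = f(jh)` for `|j| ≤ N` (`cardinalSum_node`), and `|C_N(x)| ≤ Σ_{|k| ≤ N} |f(kh)|`;
* Stenger's balance behind (3.4.6.9)–(3.4.6.11): with `h = √(2πd/(αN))` one has `αNh = √(2πdαN)` and
  `2πd/h = √(2πdαN)`, so the truncation factor `e^{−αNh}` and the discretisation factor `e^{−2πd/h}` both equal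
  `g(α, d, N)` (`stenger_truncation_eq_g`, `stenger_discretisation_eq_g`), and `g → 0` (`tendsto_stengerRate`).
The analytic error bounds (3.4.6.8), (3.4.6.10) themselves (class `B(𝒟_d)`) are not formalised.

References: [cite: DavisRabinowitz1984, Sect. 3.4.6 (3.4.6.1)-(3.4.6.2), (3.4.6.9)-(3.4.6.11)].
-/

namespace Literature.Analysis.Quadrature

open Real Finset Filter Topology

/-! ## The sinc basis `S(x; k, h)` (3.4.6.2) -/

/-- `S(x; k, h) = sin[(π/h)(x − kh)] / [(π/h)(x − kh)]`, with the value `1` at `x = kh`.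
[cite: DavisRabinowitz1984, Sect. 3.4.6 (3.4.6.2)] -/
noncomputable def sincBasis (h : ℝ) (k : ℤ) (x : ℝ) : ℝ := sinc (π / h * (x - k * h))

/-- Away from the node, `S(x; k, h)` is the quotient `sin[(π/h)(x − kh)] / [(π/h)(x − kh)]`.
[cite: DavisRabinowitz1984, Sect. 3.4.6 (3.4.6.2)] -/
theorem sincBasis_eq_div {h : ℝ} (hh : h ≠ 0) {k : ℤ} {x : ℝ} (hx : x ≠ k * h) :
    sincBasis h k x = Real.sin (π / h * (x - k * h)) / (π / h * (x - k * h)) := by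
  unfold sincBasis
  exact sinc_of_ne_zero (mul_ne_zero (div_ne_zero pi_ne_zero hh) (sub_ne_zero.2 hx))

/-- Cardinal property, diagonal: `S(kh; k, h) = 1`. [cite: DavisRabinowitz1984, Sect. 3.4.6 (3.4.6.2)] -/
theorem sincBasis_node_self (h : ℝ) (k : ℤ) : sincBasis h k (k * h) = 1 := by
  simp [sincBasis]

/-- Cardinal property, off-diagonal: `S(jh; k, h) = 0` for `j ≠ k` (`h ≠ 0`).
[cite: DavisRabinowitz1984, Sect. 3.4.6 (3.4.6.2)] -/
theorem sincBasis_node_of_ne {h : ℝ} (hh : h ≠ 0) {j k : ℤ} (hjk : j ≠ k) : sincBasis h k (j * h) = 0 := by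
  have hne : (j : ℝ) * h ≠ k * h := by
    intro e; apply hjk; exact_mod_cast mul_right_cancel₀ hh e
  rw [sincBasis_eq_div hh hne]
  have : π / h * (j * h - k * h) = ((j - k : ℤ) : ℝ) * π := by
    push_cast; field_simp
  rw [this, Real.sin_int_mul_pi, zero_div]

/-- `|S(x; k, h)| ≤ 1`. [cite: DavisRabinowitz1984, Sect. 3.4.6 (3.4.6.2)] -/
theorem abs_sincBasis_le_one (h : ℝ) (k : ℤ) (x : ℝ) : |sincBasis h k x| ≤ 1 := abs_sinc_le_one _

/-- `S(·; k, h)` is continuous (the singularity at `kh` is removable). [cite: DavisRabinowitz1984, Sect. 3.4.6 (3.4.6.2)] -/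
theorem continuous_sincBasis (h : ℝ) (k : ℤ) : Continuous (sincBasis h k) := by
  unfold sincBasis; fun_prop

/-- Symmetry about the node: `S(2kh − x; k, h) = S(x; k, h)`. [cite: DavisRabinowitz1984, Sect. 3.4.6 (3.4.6.2)] -/
theorem sincBasis_symm (h : ℝ) (k : ℤ) (x : ℝ) : sincBasis h k (2 * (k * h) - x) = sincBasis h k x := by
  unfold sincBasis
  rw [show π / h * (2 * (k * h) - x - k * h) = -(π / h * (x - k * h)) by ring, sinc_neg]

/-- All basis functions are translates of one: `S(x; k, h) = S(x − kh; 0, h)`.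
[cite: DavisRabinowitz1984, Sect. 3.4.6 (3.4.6.2)] -/
theorem sincBasis_eq_shift (h : ℝ) (k : ℤ) (x : ℝ) : sincBasis h k x = sincBasis h 0 (x - k * h) := by
  simp [sincBasis]

/-! ## The (truncated) cardinal series (3.4.6.1), (3.4.6.7) -/

/-- `C_N(x; f, h) = Σ_{k=−N}^{N} f(kh) S(x; k, h)`. [cite: DavisRabinowitz1984, Sect. 3.4.6 (3.4.6.1)] -/
noncomputable def cardinalSum (N : ℕ) (f : ℝ → ℝ) (h x : ℝ) : ℝ :=
  ∑ k ∈ Icc (-(N : ℤ)) N, f (k * h) * sincBasis h k x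

/-- **Interpolation.** `C_N(jh; f, h) = f(jh)` for `|j| ≤ N` (`h ≠ 0`). [cite: DavisRabinowitz1984, Sect. 3.4.6 (3.4.6.1)] -/
theorem cardinalSum_node {h : ℝ} (hh : h ≠ 0) (N : ℕ) (f : ℝ → ℝ) {j : ℤ} (hj : j ∈ Icc (-(N : ℤ)) N) :
    cardinalSum N f h (j * h) = f (j * h) := by
  unfold cardinalSum
  rw [sum_eq_single_of_mem j hj]
  · rw [sincBasis_node_self, mul_one]
  · intro k _ hkj
    rw [sincBasis_node_of_ne hh (Ne.symm hkj), mul_zero]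

/-- Outside the sampled range the truncated series still vanishes at the nodes: `C_N(jh) = 0` for `|j| > N`.
[cite: DavisRabinowitz1984, Sect. 3.4.6 (3.4.6.1)] -/
theorem cardinalSum_node_of_not_mem {h : ℝ} (hh : h ≠ 0) (N : ℕ) (f : ℝ → ℝ) {j : ℤ}
    (hj : j ∉ Icc (-(N : ℤ)) N) : cardinalSum N f h (j * h) = 0 := by
  unfold cardinalSum
  refine sum_eq_zero fun k hk => ?_
  have : j ≠ k := fun e => hj (e ▸ hk)
  rw [sincBasis_node_of_ne hh this, mul_zero]

/-- `|C_N(x; f, h)| ≤ Σ_{|k| ≤ N} |f(kh)|`. [cite: DavisRabinowitz1984, Sect. 3.4.6 (3.4.6.1)] -/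
theorem abs_cardinalSum_le (N : ℕ) (f : ℝ → ℝ) (h x : ℝ) :
    |cardinalSum N f h x| ≤ ∑ k ∈ Icc (-(N : ℤ)) N, |f (k * h)| := by
  unfold cardinalSum
  refine (abs_sum_le_sum_abs _ _).trans (sum_le_sum fun k _ => ?_)
  rw [abs_mul]
  exact mul_le_of_le_one_right (abs_nonneg _) (abs_sincBasis_le_one h k x)

/-- `C_N(·; f, h)` is continuous. [cite: DavisRabinowitz1984, Sect. 3.4.6 (3.4.6.1)] -/
theorem continuous_cardinalSum (N : ℕ) (f : ℝ → ℝ) (h : ℝ) : Continuous (cardinalSum N f h) := by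
  unfold cardinalSum
  exact continuous_finsetSum _ fun k _ => continuous_const.mul (continuous_sincBasis h k)

/-! ## Stenger's step size (3.4.6.9) and rate (3.4.6.11) -/

/-- The step `h = [2πd/(αN)]^{1/2}` (3.4.6.9). [cite: DavisRabinowitz1984, Sect. 3.4.6 (3.4.6.9)] -/
noncomputable def stengerStep (α d : ℝ) (N : ℕ) : ℝ := Real.sqrt (2 * π * d / (α * N))

/-- The rate `g(α, d, N) = exp[−(2πdαN)^{1/2}]` (3.4.6.11). [cite: DavisRabinowitz1984, Sect. 3.4.6 (3.4.6.11)] -/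
noncomputable def stengerRate (α d : ℝ) (N : ℕ) : ℝ := Real.exp (-Real.sqrt (2 * π * d * α * N))

/-- `0 < g(α, d, N) ≤ 1`. [cite: DavisRabinowitz1984, Sect. 3.4.6 (3.4.6.11)] -/
theorem stengerRate_pos_le_one (α d : ℝ) (N : ℕ) : 0 < stengerRate α d N ∧ stengerRate α d N ≤ 1 := by
  unfold stengerRate
  exact ⟨Real.exp_pos _, Real.exp_le_one_iff.2 (neg_nonpos.2 (Real.sqrt_nonneg _))⟩

/-- Balance, truncation side: with `h` as in (3.4.6.9), `α N h = (2πdαN)^{1/2}`.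
[cite: DavisRabinowitz1984, Sect. 3.4.6 (3.4.6.9)] -/
theorem stenger_alpha_N_h {α : ℝ} (d : ℝ) (hα : 0 < α) {N : ℕ} (hN : 0 < N) :
    α * N * stengerStep α d N = Real.sqrt (2 * π * d * α * N) := by
  unfold stengerStep
  have hαN : (0 : ℝ) < α * N := mul_pos hα (by exact_mod_cast hN)
  rw [show Real.sqrt (2 * π * d * α * N) = Real.sqrt ((α * N) ^ 2 * (2 * π * d / (α * N))) by
    congr 1; field_simp]
  rw [Real.sqrt_mul (sq_nonneg _), Real.sqrt_sq hαN.le]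

/-- Balance, discretisation side: with `h` as in (3.4.6.9), `2πd/h = (2πdαN)^{1/2}`.
[cite: DavisRabinowitz1984, Sect. 3.4.6 (3.4.6.9)] -/
theorem stenger_two_pi_d_div_h {α d : ℝ} (hα : 0 < α) (hd : 0 < d) {N : ℕ} (hN : 0 < N) :
    2 * π * d / stengerStep α d N = Real.sqrt (2 * π * d * α * N) := by
  have hαN : (0 : ℝ) < α * N := mul_pos hα (by exact_mod_cast hN)
  have h2 : (0 : ℝ) < 2 * π * d := by positivity
  have hh : 0 < stengerStep α d N := Real.sqrt_pos.2 (div_pos h2 hαN)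
  rw [div_eq_iff hh.ne', ← stenger_alpha_N_h d hα hN]
  -- `2πd = (αN h) h` since `h² = 2πd/(αN)`
  have hsq : stengerStep α d N ^ 2 = 2 * π * d / (α * N) := by
    unfold stengerStep; rw [Real.sq_sqrt (div_pos h2 hαN).le]
  have key : α * N * stengerStep α d N ^ 2 = 2 * π * d := by
    rw [hsq]; field_simp
  rw [show α * (N : ℝ) * stengerStep α d N * stengerStep α d N = α * N * stengerStep α d N ^ 2 by ring, key]

/-- Hence the truncation factor `e^{−αNh}` equals `g(α, d, N)`. [cite: DavisRabinowitz1984, Sect. 3.4.6 (3.4.6.11)] -/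
theorem stenger_truncation_eq_g {α : ℝ} (d : ℝ) (hα : 0 < α) {N : ℕ} (hN : 0 < N) :
    Real.exp (-(α * N * stengerStep α d N)) = stengerRate α d N := by
  rw [stenger_alpha_N_h d hα hN]; rfl

/-- … and the discretisation factor `e^{−2πd/h}` equals `g(α, d, N)` as well — the two error sources are balanced.
[cite: DavisRabinowitz1984, Sect. 3.4.6 (3.4.6.11)] -/
theorem stenger_discretisation_eq_g {α d : ℝ} (hα : 0 < α) (hd : 0 < d) {N : ℕ} (hN : 0 < N) :
    Real.exp (-(2 * π * d / stengerStep α d N)) = stengerRate α d N := by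
  rw [stenger_two_pi_d_div_h hα hd hN]; rfl

/-- The rate tends to `0` as `N → ∞` (for `α, d > 0`): root-exponential convergence.
[cite: DavisRabinowitz1984, Sect. 3.4.6 (3.4.6.11)] -/
theorem tendsto_stengerRate {α d : ℝ} (hα : 0 < α) (hd : 0 < d) :
    Tendsto (fun N : ℕ => stengerRate α d N) atTop (𝓝 0) := by
  unfold stengerRate
  have hc : 0 < 2 * π * d * α := by positivity
  refine Real.tendsto_exp_atBot.comp ?_
  refine tendsto_neg_atTop_atBot.comp ?_
  refine (Real.tendsto_sqrt_atTop).comp ?_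
  exact Tendsto.const_mul_atTop hc tendsto_natCast_atTop_atTop

end Literature.Analysis.Quadrature
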